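import Summits.ResolutionOfSingularities.ResolutionOfSingularities.Theorems.FrobeniusLadderFRationalResolutionCartierDescentFlat
import Summits.ResolutionOfSingularities.ResolutionOfSingularities.Theorems.FrobeniusLadderFRationalResolutionBlowupFlatCriteria
import Literature.AlgebraicGeometry.Resolution.BlowupsFlatBaseChange
import Literature.AlgebraicGeometry.Resolution.BlowupsLocal
import Mathlib.AlgebraicGeometry.Morphisms.Flat
import HarnessLib

/-!
# Crux `FrobeniusLadder.FRationalResolution` (stmt-ResolutionOfSingularities-15317), line `redirect`,
# stub `stub_diagonalizableQuotientResolution` — Cartier-ness of an ideal on an affine blow-up can be checked after a FLAT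
# SURJECTIVE base change of the base ring

For `φ : B → C` with `Spec C → Spec B` flat and surjective (`B` Noetherian) and ideals `I, L ⊆ B`: if `π'⁻¹(LC)~` is an effective
Cartier divisor on `Bl_{IC}(Spec C)`, then `π⁻¹L̃` is an effective Cartier divisor on `Bl_I(Spec B)`. Indeed `Bl_{IC}(Spec C) ≅
Bl_I(Spec B) ×_B C` (blow-ups commute with flat base change, GW 13.91 (2), tree `IsBlowup.pullback_snd_of_flat` + uniqueness), the
projection to `Bl_I(Spec B)` is flat and surjective, and effective Cartier divisors descend along such maps
(`…CartierDescentFlat.IsEffectiveCartier.of_comap_of_flat_of_surjective`). Use: the hypothesis `htw` of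
`…GaloisSymmetrizedPieceRegular` / the Cartier hypothesis of `…BlowupAbsorbsCartier` for the twists of a piece on `Bl_{I₁}(Spec B'_h)`
may be verified on the chart side `C`, where `I₁C = JC` is monomial (after shrinking `B'_h` into the open image of the étale chart).

* **`isEffectiveCartier_comap_affineBlowup_of_flat_surjective`** — the statement above.

Honest label: generic scheme plumbing toward ONE leaf stub (no stub, crux or summit closed). No definitions, no named facts, no
sorry. [cite: GortzWedhorn2020, Prop. 13.91 (2)] [cite: StacksProject, Tag 02OO]
-/

noncomputable section

-- single-problem summit: the doubled namespace component is forced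
set_option linter.dupNamespace false

open CategoryTheory CategoryTheory.Limits AlgebraicGeometry
open Literature.AlgebraicGeometry.Resolution
open Summit.ResolutionOfSingularities.ResolutionOfSingularities.Theorems.FRationalResolution

namespace Summit.ResolutionOfSingularities.ResolutionOfSingularities.Theorems.FRationalResolution.BlowupCartierBaseChange

universe u

/-- **Cartier-ness on `Bl_I(Spec B)` descends from `Bl_{IC}(Spec C)` for `Spec C → Spec B` flat and surjective.**
[cite: GortzWedhorn2020, Prop. 13.91 (2)] [cite: StacksProject, Tag 02OO] -/
theorem isEffectiveCartier_comap_affineBlowup_of_flat_surjective {B C : Type u} [CommRing B] [CommRing C]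
    [IsNoetherianRing B] (φ : B →+* C) [Flat (Spec.map (CommRingCat.ofHom φ))]
    [Surjective (Spec.map (CommRingCat.ofHom φ))] (I L : Ideal B)
    (h : IsEffectiveCartier ((affineBlowup.idealSheaf (L.map φ)).comap (affineBlowup.π (I.map φ)))) :
    IsEffectiveCartier ((affineBlowup.idealSheaf L).comap (affineBlowup.π I)) := by
  set j := Spec.map (CommRingCat.ofHom φ) with hj
  haveI : IsLocallyNoetherian (affineBlowup I) := LocallyOfFiniteType.isLocallyNoetherian (affineBlowup.π I)
  -- the base change of `Bl_I(Spec B)` along `j` is a blow-up of `Spec C` along `(IC)~`, hence `≅ Bl_{IC}(Spec C)`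
  have hbc : IsBlowup (pullback.snd (affineBlowup.π I) j) (affineBlowup.idealSheaf (I.map φ)) := by
    rw [← BlowupFlatCriteria.idealSheaf_comap_specMap]
    exact (affineBlowup.isBlowup I).pullback_snd_of_flat j
  obtain ⟨e, he, -⟩ := hbc.unique (affineBlowup.isBlowup (I.map φ))
  -- pull the ideal sheaf back to the fibre product through `Bl_{IC}(Spec C)`
  have hK : (((affineBlowup.idealSheaf L).comap (affineBlowup.π I)).comap (pullback.fst (affineBlowup.π I) j)) =
      (((affineBlowup.idealSheaf (L.map φ)).comap (affineBlowup.π (I.map φ))).comap e.hom) := by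
    rw [← Scheme.IdealSheafData.comap_comp, ← Scheme.IdealSheafData.comap_comp, pullback.condition, he,
      Scheme.IdealSheafData.comap_comp, hj, BlowupFlatCriteria.idealSheaf_comap_specMap]
  have hcart : IsEffectiveCartier
      (((affineBlowup.idealSheaf L).comap (affineBlowup.π I)).comap (pullback.fst (affineBlowup.π I) j)) := by
    rw [hK]
    exact h.comap_iso e
  -- descend along the flat surjective projection
  exact CartierDescentFlat.IsEffectiveCartier.of_comap_of_flat_of_surjective (pullback.fst (affineBlowup.π I) j) _ hcart

end Summit.ResolutionOfSingularities.ResolutionOfSingularities.Theorems.FRationalResolution.BlowupCartierBaseChange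

end
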